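import Literature.AlgebraicGeometry.Resolution.PointBlowupShade
import Mathlib.NumberTheory.Padics.PadicVal.Defs
import HarnessLib

/-!
# Coordinate-subspace centres, the obliquity order condition and the oasis bound — statement-level typing

`Literature/AlgebraicGeometry/Resolution/PointBlowupShadeCentres.lean` (resolution observatory
`pub-rosobs`, carver/typer gen 2). Continues `PointBlowupShade.lean` (the point-blow-up state
`(F, r)` of a purely inseparable hypersurface `x^q + F(y)`, its shade, Hauser's conditions (1)–(3),
Hauser–Perlega's (6)–(7)) with the three notions the atlas' second generation evaluates, as
DEFINITIONS over `MvPolynomial σ K` (no theorem about resolution is asserted; the computable mirror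
with `decide`d rows is `KangarooAtlasCertCentres.lean`):

1. **Blow-ups in coordinate-subspace centres** `C_S = {x = 0, yᵢ = 0 (i ∈ S)}`, `S ⊆ σ`: the
   `I(C_S)`-adic order `ordAlong`, the chart law `y^d ↦ y^{d'}`, `d'_j = Σ_{i∈S} dᵢ − q` (Hauser–Perlega
   2019 §2: "`xᵢ ↦ x₁xᵢ` for `i ∈ S∖T`", division of the total transform by `x₁^c`), the state with its
   set of exceptional components, and the admissibility predicate of the atlas' rule `bm`:
   permissibility "the center `Z` of `π` is regular, has normal crossings with `D` and … is contained
   in … the equimultiple loci of `J` and `I`" [cite: HauserPerlega2019PRIMS, §2], the top-locus clause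
   (general shade along `C_S` = shade at the point), and `S ⊇` the exceptional components through the
   point — the atlas' transcription (every component treated as "old") of Bierstone–Milman's
   "`s(x) := #{H ∈ E : x ∈ H}`", entering the invariant before the next order ("`inv_I(x) := (s,
   inv_J(x))`"), and "the centre `C` of each admissible blowing-up lies inside the intersection of the
   components of `E` that pass through a point of `C`"; centres "given by the maximum locus of
   `(inv_I, J_I)`" [cite: BierstoneMilman2008, §5 Step I Case B (p. 627), §7 (p. 635), Thm 7.1 (2)].
   The order of the re-cleaned `F` at a
   GENERAL closed point of `C_S` is typed by the explicit monomial formula the engines use (Lucas'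
   theorem; see `genericTermOrder`), flagged as the atlas' convention.
2. **Condition (4)** of the Kangaroo Theorem / of Hauser–Perlega's theorem, the order half of
   obliqueness, at a GIVEN shear vector: Hauser 2010 §I — "`P⁺(y) = (y + t·y_m)ʳ g(y + t·y_m)` has,
   after deleting all `p`th power monomials from it, order `k + 1` with respect to the variables
   `y_ℓ, …, y₁` … the condition `ord^p_z P⁺ ≥ k + 1` on `P⁺` is a prerequisite for the occurence of a
   kangaroo point" [cite: Hauser2010, §I p. 23]; Hauser–Perlega 2019 §3 (4) — "`ord^{mod pᵉ}_{Q_T} F > u`"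
   with `u = deg F − Σ_{i∈T} rᵢ`, `Q_T = (xᵢ − tᵢx₁ (i ∈ T∖{1}), xᵢ (i ∉ T))`
   [cite: HauserPerlega2019PRIMS, §3 Theorem (4)] — as `ObliqueOrderCondition q j t u P :=
   u < ord^q_{≠j}(shear_{j,t} P)` over the tree's `Hauser2010.shear` / `pOrderAwayFrom`; a pre-oblique
   polynomial (`Hauser2010.IsPreOblique`) satisfies it for some `t ∈ (K*)^{σ∖j}` (proved, one line).
   Condition (2) of Hauser–Perlega ("the order `o` of the coefficient ideal … is a multiple `o = w·c!`
   of `c!`, with `w ≥ 2`"; for `x^q + F`: `q ∣ ord F` and `2q ≤ ord F`) is typed alongside.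
3. **The oasis bound** of Hauser 2010 §J ("Fact. … `shade_a f ≤ ⌊½·shade_{a°} f°⌋`"; "It seems
   challenging to establish a similar statement for singular three-folds in four-space")
   [cite: Hauser2010, §J p. 24] as a predicate on the two shades.
-/

open MvPolynomial Finset

open scoped BigOperators

noncomputable section

namespace Literature.AlgebraicGeometry.Resolution

open Literature.AlgebraicGeometry.Resolution.Hauser2010

/-! ## 1. Coordinate-subspace centres -/

namespace CentreBlowup

variable {σ : Type*} {K : Type*} [CommRing K]

/-- `Σ_{i∈S} dᵢ`: the `I(C_S)`-adic order of the monomial `y^d`. [folklore] -/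
def degIn (S : Finset σ) (d : σ →₀ ℕ) : ℕ := ∑ i ∈ S, d i

/-- For `S` = all variables, `degIn` is the total degree. [folklore] -/
theorem degIn_univ [Fintype σ] (d : σ →₀ ℕ) : degIn Finset.univ d = d.degree := by
  rw [degIn, Finsupp.degree_eq_sum]

/-- The **order of `F` along `C_S`** (`ord_P F` for `P = (yᵢ : i ∈ S)`, Hauser–Perlega's `ord_P`): the
least `Σ_{i∈S} dᵢ` over the monomials of `F`; `⊤` for `F = 0`. `C_S` lies in the equimultiple locus of
`x^q + F` iff `q ≤ ordAlong S F`. [cite: HauserPerlega2019PRIMS, §2 (permissible blowups, `ord_P`)] -/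
def ordAlong (S : Finset σ) (F : MvPolynomial σ K) : ℕ∞ :=
  F.support.inf fun d => (degIn S d : ℕ∞)

/-- The exponent law of the `y_j`-chart of the blow-up of `C_S` (`j ∈ S`) followed by division by
`y_j^q`: `d'_i = dᵢ` (`i ≠ j`), `d'_j = Σ_{i∈S} dᵢ − q` ("`xᵢ ↦ x₁xᵢ` for `i ∈ S`", the `x₁`-chart).
Natural-number subtraction: meaningful when `q ≤ ordAlong S F`.
[cite: HauserPerlega2019PRIMS, §2 (the blowup in the x₁-chart)] -/
def chartExponent [DecidableEq σ] (q : ℕ) (S : Finset σ) (j : σ) (d : σ →₀ ℕ) : σ →₀ ℕ :=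
  d.update j (degIn S d - q)

/-- For the point (`S` = all variables) this is the chart law of `PointBlowupShade`. [folklore] -/
theorem chartExponent_univ [Fintype σ] [DecidableEq σ] (q : ℕ) (j : σ) (d : σ →₀ ℕ) :
    chartExponent q Finset.univ j d = PointBlowup.chartExponent q j d := by
  rw [chartExponent, PointBlowup.chartExponent, degIn_univ]

/-- The **chart transform** of `F` under the blow-up of `C_S`, chart `y_j`.
[cite: HauserPerlega2019PRIMS, §2 (the blowup in the x₁-chart)] -/
def chartTransform [DecidableEq σ] (q : ℕ) (S : Finset σ) (j : σ) (F : MvPolynomial σ K) :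
    MvPolynomial σ K :=
  ∑ d ∈ F.support, monomial (chartExponent q S j d) (coeff d F)

/-- A **state** of the coordinate-centre walk: residual polynomial `F` (cleaned), exceptional
multiplicities `r`, and the set `exc` of exceptional components `{yᵢ = 0}` through the point (a
component may pass through the point with multiplicity `0`, so `exc` is not recoverable from `r`).
[cite: Hauser2010, §F (setting f = x^p + y^r g)] [cite: BierstoneMilman2008, §5 (s(x) = #{H ∈ E : x ∈ H})] -/
structure CState (σ : Type*) (K : Type*) [CommRing K] where
  /-- the residual polynomial `F(y)` of `x^q + F(y)` -/
  F : MvPolynomial σ K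
  /-- the exceptional multiplicities -/
  r : σ →₀ ℕ
  /-- the exceptional components through the point -/
  exc : Finset σ

namespace CState

/-- the underlying point-blow-up state `(F, r)`. [folklore] -/
def toState (s : CState σ K) : PointBlowup.State σ K := ⟨s.F, s.r⟩

/-- the shade `ord₀ F − |r|`. [cite: Hauser2010, §F (definition of the shade)] -/
def shade (s : CState σ K) : ℕ∞ := ordZero s.F - (s.r.degree : ℕ∞)

/-- the shade of a `CState` is the shade of its underlying state. [folklore] -/
theorem shade_toState (s : CState σ K) : s.toState.shade = s.shade := rfl

end CState

/-- Contribution of the monomial `y^d = y_N^a·y_S^b` (`N = σ ∖ S`) to the order of the RE-CLEANED `F`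
at a general closed point of `C_S`: `|b|` if `q ∤ bᵢ` for some `i ∈ S`; otherwise `|b| +
min {p^{v_p(aᵢ)} : i ∉ S, q ∤ aᵢ}` — the least degree of a non-`q`-th-power term of
`(y_N + c)^a y_S^b` for general `c`, by Lucas' theorem (`C(aᵢ, k) ≢ 0 mod p` iff `k ≤_p aᵢ`
digitwise; the least such `k` not divisible by `q = pᵉ` is `p^{v_p(aᵢ)}` when `q ∤ aᵢ`); `⊤` if every
exponent is divisible by `q`. This is the ATLAS' CONVENTION (rule text KANGAROO-ATLAS-CC-bm §0 (i)),
typed here so that the engines' admissibility test has a tree-side name; it is not a quotation.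
[folklore] -/
def genericTermOrder [DecidableEq σ] (p q : ℕ) (S : Finset σ) (d : σ →₀ ℕ) : ℕ∞ :=
  if ∃ i ∈ S, ¬ q ∣ d i then (degIn S d : ℕ∞)
  else (d.support.filter fun i => i ∉ S ∧ ¬ q ∣ d i).inf
    fun i => ((degIn S d + p ^ padicValNat p (d i) : ℕ) : ℕ∞)

/-- Order of the re-cleaned `F` at a general closed point of `C_S` (atlas convention, see
`genericTermOrder`); `⊤` for `F = 0`. [folklore] -/
def genericOrder [DecidableEq σ] (p q : ℕ) (S : Finset σ) (F : MvPolynomial σ K) : ℕ∞ :=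
  F.support.inf fun d => genericTermOrder p q S d

/-- **Admissible coordinate centre** (atlas rule, clauses (i)–(ii)): `S ≠ ∅`, the general-point order
along `C_S` is `≥ q` (equimultiplicity: "the center … is contained in … the equimultiple loci",
Hauser–Perlega §2), and the general shade along `C_S`, `genericOrder − Σ_{i∈S} rᵢ`, equals the shade
at the point (the germ of `C_S` lies in the top locus of `(ord, shade)`).
[cite: HauserPerlega2019PRIMS, §2 (permissible blowups)] [cite: Hauser2010, §F (top locus, shade)] -/
def IsAdmissibleCentre [DecidableEq σ] (p q : ℕ) (S : Finset σ) (s : CState σ K) : Prop :=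
  S.Nonempty ∧ (q : ℕ∞) ≤ genericOrder p q S s.F ∧
    genericOrder p q S s.F - (degIn S s.r : ℕ∞) = s.shade

/-- **Rule `bm`**: admissible AND containing every exceptional component through the point ("the
centre `C` of each admissible blowing-up lies inside the intersection of the components of `E` that
pass through a point of `C`", Bierstone–Milman 2008 §5, Step I Case B, with `s(x) = #{H ∈ E : x ∈ H}`
entering `inv_I(x) := (s, inv_J(x))` before the next order; the atlas treats every component as a
component of `E`). [cite: BierstoneMilman2008, §5 Step I Case B (p. 627), §7 (p. 635)] -/
def IsBMCentre [DecidableEq σ] (p q : ℕ) (S : Finset σ) (s : CState σ K) : Prop :=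
  s.exc ⊆ S ∧ IsAdmissibleCentre p q S s

/-- **The centre the walk blows up**: a `bm`-admissible `S` of least cardinality (largest dimension of
`C_S`; "Each centre of blowing up `C_j ⊂ M_j` is given by the maximum locus of `(inv_I, J_I)` on
`cosupp I_j`" — entries of the invariant beyond `(ord, s, shade)` are not modelled, ties are all
followed by the atlas). [cite: BierstoneMilman2008, Thm 7.1 (2)] -/
def IsChosenCentre [DecidableEq σ] (p q : ℕ) (S : Finset σ) (s : CState σ K) : Prop :=
  IsBMCentre p q S s ∧ ∀ S' : Finset σ, IsBMCentre p q S' s → S.card ≤ S'.card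

/-- The polynomial seen at the point `b` of the `y_j`-chart of the blow-up of `C_S`, before cleaning.
[cite: HauserPerlega2019PRIMS, §2 (the blowup in the x₁-chart)] -/
def pointTransform [DecidableEq σ] (q : ℕ) (S : Finset σ) (j : σ) (b : σ → K) (s : CState σ K) :
    MvPolynomial σ K :=
  PointBlowup.translate b (chartTransform q S j s.F)

/-- Equimultiple (equiconstant) point above the centre: the transform is again `q`-fold there.
[cite: Hauser2010, §F (equiconstant points)] -/
def IsEquimultiplePoint [DecidableEq σ] (q : ℕ) (S : Finset σ) (j : σ) (b : σ → K) (s : CState σ K) :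
    Prop :=
  ∀ d : σ →₀ ℕ, d ≠ 0 → d.degree < q → coeff d (pointTransform q S j b s) = 0

/-- New multiplicities: the new component `{y_j = 0}` gets `ord_{C_S} F − q` ("`D' = D^s + (ord_P 𝒦 − c!)·E`",
Hauser–Perlega §2, here for `x^q + F`), a translated coordinate (`bᵢ ≠ 0`) loses its component.
[cite: HauserPerlega2019PRIMS, §2 (transform D' of D)] [cite: Hauser2010, §F (transform D')] -/
def newMult [DecidableEq σ] [DecidableEq K] (q : ℕ) (S : Finset σ) (j : σ) (b : σ → K)
    (s : CState σ K) : σ →₀ ℕ :=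
  (s.r.filter fun i => b i = 0).update j ((ordAlong S s.F).toNat - q)

/-- New set of exceptional components through the point: `{y_j = 0}` and the old ones the point stays on.
[cite: Hauser2010, §F (transform D')] -/
def newExc [DecidableEq σ] [DecidableEq K] (j : σ) (b : σ → K) (s : CState σ K) : Finset σ :=
  insert j (s.exc.filter fun i => b i = 0)

/-- One **step** of the coordinate-centre walk at the point `b` of the `y_j`-chart of the blow-up of
`C_S`: chart transform, translation, cleaning (`x ↦ x + h(y)`), new multiplicities and components.
[cite: Hauser2010, §§F–G (blowup followed by cleaning)] [cite: HauserPerlega2019PRIMS, §2] -/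
def step [DecidableEq σ] [DecidableEq K] (q : ℕ) (S : Finset σ) (j : σ) (b : σ → K) (s : CState σ K) :
    CState σ K where
  F := deletePthPowers q (pointTransform q S j b s)
  r := newMult q S j b s
  exc := newExc j b s

/-- The shade **increases** at the point `b` above the centre `C_S`. [cite: Hauser2010, §F (increase of the shade)] -/
def ShadeIncreases [DecidableEq σ] [DecidableEq K] (q : ℕ) (S : Finset σ) (j : σ) (b : σ → K)
    (s : CState σ K) : Prop :=
  s.shade < (step q S j b s).shade

/-- **Kangaroo point above a coordinate centre**: `j ∈ S`, `b` on the exceptional divisor (`b_j = 0`)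
and over the point (`bᵢ = 0` for `i ∉ S`: the atlas registers other points of `C_S` as separate
states), `C_S` equimultiple, the new point equimultiple, and the shade increased.
[cite: Hauser2010, §G (kangaroo points)] [cite: HauserPerlega2019PRIMS, §3 Theorem (hypotheses)] -/
def IsKangarooPoint [DecidableEq σ] [DecidableEq K] (q : ℕ) (S : Finset σ) (j : σ) (b : σ → K)
    (s : CState σ K) : Prop :=
  j ∈ S ∧ b j = 0 ∧ (∀ i, i ∉ S → b i = 0) ∧ (q : ℕ∞) ≤ ordAlong S s.F ∧
    IsEquimultiplePoint q S j b s ∧ ShadeIncreases q S j b s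

end CentreBlowup

/-! ## 2. Condition (4): the obliquity order condition at a given shear vector; condition (2) -/

namespace HauserPerlega2019

variable {σ : Type*} {K : Type*} [CommRing K]

/-- The **initial form** of `F`: its homogeneous component of degree `ord₀ F` (`0` for `F = 0`).
[cite: HauserPerlega2019PRIMS, §3 Theorem (3) (the homogeneous polynomial F)] -/
def initialForm (F : MvPolynomial σ K) : MvPolynomial σ K :=
  homogeneousComponent (ordZero F).toNat F

/-- **Condition (4)** at the shear vector `t` (`t_j = 0`; Hauser's `P⁺ = P(y + t·y_j)`, Hauser–Perlega's
`Q_T` with `T = {j} ∪ {i : tᵢ ≠ 0}`): `ord^{mod q}_{Q_T} P > u`, i.e. after the shear and the deletion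
of the `q`-th-power monomials the order in the variables other than `y_j` exceeds `u`. With `u = k`
(all components left) equality `= k + 1` is the order clause of `Hauser2010.IsPreOblique`.
[cite: HauserPerlega2019PRIMS, §3 Theorem (4)] [cite: Hauser2010, §I p. 23 (ord^p_z P⁺ ≥ k + 1)] -/
def ObliqueOrderCondition [DecidableEq σ] (q : ℕ) (j : σ) (t : σ → K) (u : ℕ) (P : MvPolynomial σ K) :
    Prop :=
  (u : ℕ∞) < pOrderAwayFrom q j (shear j t P)

/-- A pre-oblique polynomial with parameters `(p, r, k)` satisfies condition (4) with `u = k` for some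
admissible shear vector. [cite: Hauser2010, §I (definition of oblique, ord^p_z P⁺ = k + 1)] -/
theorem obliqueOrderCondition_of_isPreOblique [DecidableEq σ] {p : ℕ} {j : σ} {r : σ →₀ ℕ} {k : ℕ}
    {P : MvPolynomial σ K} (h : IsPreOblique p j r k P) :
    ∃ t : σ → K, t j = 0 ∧ (∀ i, i ≠ j → t i ≠ 0) ∧ ObliqueOrderCondition p j t k P := by
  obtain ⟨t, h0, hne, heq⟩ := h.exists_shear
  refine ⟨t, h0, hne, ?_⟩
  unfold ObliqueOrderCondition
  rw [heq]
  exact_mod_cast Nat.lt_succ_self k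

/-- Hauser's Example 5 / the antelope of §K: `P = y₂³y₁³(y₂² + y₁²)`, `p = 2`, `k = 2`, shear `t = (1, 0)`
(distinguished variable `y₂`): condition (4) holds with `u = 2` (`ord^2_{y₁} P⁺ = 3`, proved in
`Hauser2010.pOrderAwayFrom_exampleFive`). [cite: Hauser2010, §I Examples 4–5] -/
theorem obliqueOrderCondition_exampleFive (K : Type*) [CommRing K] [CharP K 2] [Nontrivial K] :
    ObliqueOrderCondition 2 1 (exampleFourShift K) 2 (exampleFive K) := by
  unfold ObliqueOrderCondition
  rw [pOrderAwayFrom_exampleFive]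
  exact_mod_cast (by norm_num : (2 : ℕ) < 3)

/-- `u = o − Σ_{i∈T} rᵢ` for the point-blow-up state `s`, chart `y_j`, point `b`, with `T` the lost
components and `r` the state's exceptional multiplicities (the atlas' reading; the printed `rᵢ` are
`ord_{(xᵢ)}` of the initial form, which are `≥` these). [cite: HauserPerlega2019PRIMS, §3 Theorem (4)] -/
def residualDegree [Fintype σ] [DecidableEq σ] [DecidableEq K] (j : σ) (b : σ → K)
    (s : PointBlowup.State σ K) : ℕ :=
  (ordZero s.F).toNat - ∑ i ∈ PointBlowup.lostComponents j b, s.r i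

/-- **Condition (4) at an edge of the point-blow-up walk**: the initial form of `F`, sheared by the
translation vector `b` of the chart `y_j`, has `ord^{mod q}` away from `y_j` exceeding `u`.
A PREDICATE; "kangaroo point ⇒ (4)" is the printed theorem and is not asserted here.
[cite: HauserPerlega2019PRIMS, §3 Theorem (4)] [cite: Hauser2010, §G Kangaroo Theorem (4), §I] -/
def Condition4 [Fintype σ] [DecidableEq σ] [DecidableEq K] (q : ℕ) (j : σ) (b : σ → K)
    (s : PointBlowup.State σ K) : Prop :=
  ObliqueOrderCondition q j b (residualDegree j b s) (initialForm s.F)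

/-- **Condition (2)** for `x^q + F`: "the order `o` of the coefficient ideal … is a multiple `o = w·c!`
of `c!`, with `w ≥ 2`" — here `c = q` and the coefficient ideal is generated by a power of `F`, so:
`ord₀ F = w·q` with `w ≥ 2`. [cite: HauserPerlega2019PRIMS, §3 Theorem (2)] -/
def OrderMultipleCondition (q : ℕ) (F : MvPolynomial σ K) : Prop :=
  ∃ w : ℕ, 2 ≤ w ∧ ordZero F = ((w * q : ℕ) : ℕ∞)

end HauserPerlega2019

/-! ## 3. The oasis bound (Hauser 2010 §J, surfaces) -/

namespace Hauser2010

/-- **Oasis bound.** "call the antelope point the point `a` immediately prior to a kangaroo point `a'`,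
and the oasis point the last point `a°` below `a` where none of the exceptional components through
`a` has appeared yet. … Fact. The shade of `f` drops between the oasis point `a°` and the antelope
point `a` of a kangaroo point `a'` at least to the integer part of its half,
`shade_a f ≤ ⌊½·shade_{a°} f°⌋`." (sequences of point blow-ups in three-dimensional ambient space;
"It seems challenging to establish a similar statement for singular three-folds in four-space.")
As a predicate on the two shades (`a ≤ ⌊o/2⌋ ↔ 2a ≤ o`). [cite: Hauser2010, §J p. 24 (Fact)] -/
def OasisBound (oasisShade antelopeShade : ℕ∞) : Prop :=
  2 * antelopeShade ≤ oasisShade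

/-- Hauser's example: oasis shade `5` (the root `y⁷ + yz⁴`), antelope shade `2`. [cite: Hauser2010, §G, §J] -/
theorem oasisBound_example : OasisBound 5 2 := by
  unfold OasisBound
  exact_mod_cast (by norm_num : (2 * 2 : ℕ) ≤ 5)

end Hauser2010


end Literature.AlgebraicGeometry.Resolution

end
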